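import Mathlib
import HarnessLib
import Summits.Ventures.LatticeQCDFlow.Exactness.NCMCGeneralSpaceReplicaProductChainPooledCLT
import Summits.Ventures.LatticeQCDFlow.Exactness.NCMCGeneralSpaceReplicaVectorCramerWold
import Summits.Ventures.LatticeQCDFlow.Exactness.NCMCGeneralSpaceReplicaTStatisticChains
import Summits.Ventures.LatticeQCDFlow.Exactness.NCMCGeneralSpaceReplicaTStatisticCoverage

/-!
# Replicas with DEPENDENT starts: the replica VECTOR of the product chain converges to the product Gaussian from ANY joint initial law, so the replica-`t` / jackknife bar keeps its universal limiting coverage `L_R(q)`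

HONEST FRAMING: exact (Metropolis-corrected) sampling algorithms for lattice gauge theory;
figures of merit are autocorrelation/cost numbers at stated couplings and volumes; no
continuum-physics claim.

Venture `LatticeQCDFlow` (cell pub-lqcd), topic `Exactness`; FANOUT row 13 (`eng-snf`, GEN-24).  NEW
WORK of the cell; composition of GEN-24 `NCMCGeneralSpaceReplicaProductChainPooledCLT` (the product
chain `replicaSweep (fun _ ↦ κ)`, its one-coordinate operator calculus), GEN-24
`NCMCGeneralSpaceReplicaVectorCramerWold` (Cramér–Wold), GEN-19's every-start CLT, and GEN-23 K / K2 /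
K3 (`tendstoInDistribution_tStat_of_pi_gaussianReal'`, `tStat_replicaVector_eq`,
`tendsto_measure_abs_tStat_le_of_pi_gaussianReal`).  No definition; nothing cited as a fact.

WHY (row 13).  GEN-23's replica-`t` results (Jc/K2/K4) assume INDEPENDENT replicas.  For the batch of
streams branched off ONE run (dependent joint start, independent evolution = the product chain of
`…ReplicaProductChainPooledCLT`) the replica means are NOT independent at any finite `n`; still, every
fixed linear combination `Σ_r t_r ȳ_{r,n}` is a time average of the bounded observable
`Σ_r t_r f ∘ eval_r` along the product chain, whose Green–Kubo variance is `(Σ_r t_r²) σ²_f` (cross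
terms vanish under `⊗π`).  GEN-19's CLT from ANY start plus Cramér–Wold give the VECTOR limit
`(√n (ȳ_{r,n} − πf))_r ⇒ N(0, σ²_f)^{⊗R}` — the same as for independent replicas — hence the studentised
replica-mean statistic has the limit law `t(Z)` and the replica-jackknife bar the universal coverage
`L_R(q)` (Student's ratio probability, GEN-24 S), whatever the dependence of the starts.

## Content
* `iterate_kop_const_mul` (§1); **`autocov_replicaSweep_weighted_sum_eq`** —
  `autocov Q (⊗π) (Σ_r t_r g∘eval_r) s = (Σ_r t_r²)·autocov κ π g s` (`∫ g dπ = 0`).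
* **`tendstoInDistribution_linComb_productChain`** (§2) — for every `t : ι → ℝ` and every joint start
  `μ`: `(√n)⁻¹ Σ_{s<n} Σ_r t_r (f(X_s(r)) − πf) ⇒ N(0, (Σ_r t_r²) σ²_f)`.
* **`tendstoInDistribution_replicaVector_productChain`** (§3) — the replica vector
  `((√n)⁻¹ Σ_{s<n} (f(X_s(r)) − πf))_r ⇒ N(0, σ²_f)^{⊗ι}` in `EuclideanSpace ℝ ι`, EVERY joint start.
* **`tendstoInDistribution_replicaTStat_productChain`**, **`tendsto_measure_abs_replicaTStat_le_productChain`**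
  (§4) — `R ≥ 2`, `σ²_f > 0`: the studentised replica-mean statistic ⇒ `t(Z)`, `Z ~ N(0,σ²_f)^{⊗R}`, and
  `P(|t_n| ≤ q) → L_R(q) = N(0,1)^{⊗R}{|t| ≤ q}` for every `q ≥ 0`, from EVERY joint initial law.

NOT CLAIMED: interacting replicas; a Doeblin power instead of the one-step minorisation; anything
numerical.
-/

namespace Summit.Ventures.LatticeQCDFlow.Exactness.GeneralNCMC

open MeasureTheory ProbabilityTheory Set Filter Finset Function WithLp
open Summit.Ventures.LatticeQCDFlow.Exactness
open scoped ENNReal NNReal Topology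

/-! ## §1 Weighted sums of one-coordinate observables -/

section Weighted

variable {ι : Type*} [DecidableEq ι] [Fintype ι] {S : Type*} [MeasurableSpace S]
  {κ : Kernel S S} [IsMarkovKernel κ] {π : Measure S} [IsProbabilityMeasure π]

omit [DecidableEq ι] [Fintype ι] [IsMarkovKernel κ] in
/-- The iterated transition operator is homogeneous. -/
theorem iterate_kop_const_mul {T : Type*} [MeasurableSpace T] (Q : Kernel T T) (a : ℝ) (g : T → ℝ) :
    ∀ t : ℕ, (Scoring.kop Q)^[t] (fun x => a * g x) = fun x => a * (Scoring.kop Q)^[t] g x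
  | 0 => rfl
  | t + 1 => by
    rw [Function.iterate_succ_apply', iterate_kop_const_mul Q a g t, Scoring.kop_const_mul,
      Function.iterate_succ_apply']

/-- **`C_{Σ_r t_r g∘eval_r}(s) = (Σ_r t_r²) · C_g(s)` along the replica sweep under the product law**
(`L` duplicate-free through every replica, `g` bounded measurable, `∫ g dπ = 0`). -/
theorem autocov_replicaSweep_weighted_sum_eq {L : List ι} (hL : L.Nodup) (hLall : ∀ r, r ∈ L)
    (c : ι → ℝ) {g : S → ℝ} (hg : Measurable g) {C : ℝ} (hC : ∀ y, |g y| ≤ C)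
    (hg0 : ∫ y, g y ∂π = 0) (s : ℕ) :
    Scoring.autocov (replicaSweep (fun _ : ι => κ) L) (Measure.pi fun _ : ι => π)
        (fun ω : ι → S => ∑ r, c r * g (ω r)) s
      = (∑ r, c r ^ 2) * Scoring.autocov κ π g s := by
  obtain ⟨hAm, hAb⟩ := Scoring.iterate_kop_bounded_measurable κ hg hC s
  set A := (Scoring.kop κ)^[s] g with hA
  have hC0 : 0 ≤ C :=
    (abs_nonneg _).trans (hC (Classical.choice (nonempty_of_isProbabilityMeasure π)))
  unfold Scoring.autocov
  -- the iterated operator acts coordinatewise and linearly on the weighted sum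
  have hiter : (Scoring.kop (replicaSweep (fun _ : ι => κ) L))^[s]
        (fun ω : ι → S => ∑ r, c r * g (ω r)) = fun ω => ∑ r, c r * A (ω r) := by
    rw [iterate_kop_finset_sum (replicaSweep (fun _ : ι => κ) L) univ
      (g := fun r (ω : ι → S) => c r * g (ω r))
      (fun r => ((hg.comp (measurable_pi_apply r)).const_mul _))
      (C := (∑ r', |c r'|) * C) ?_ s]
    · funext ω
      refine sum_congr rfl fun r _ => ?_
      rw [iterate_kop_const_mul, iterate_kop_replicaSweep_comp_eval (K := fun _ : ι => κ) hL
        (hLall r) hg hC s]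
    · intro r ω
      rw [abs_mul]
      have hcr : |c r| ≤ ∑ r', |c r'| :=
        Finset.single_le_sum (fun r' _ => abs_nonneg (c r')) (Finset.mem_univ r)
      exact mul_le_mul hcr (hC _) (abs_nonneg _) ((abs_nonneg _).trans hcr)
  rw [hiter, ← hA]
  have hprod : (fun ω : ι → S => (∑ r, c r * g (ω r)) * ∑ r', c r' * A (ω r'))
      = fun ω => ∑ r, ∑ r', (c r * c r') * (g (ω r) * A (ω r')) := by
    funext ω; rw [sum_mul_sum]; exact sum_congr rfl fun r _ => sum_congr rfl fun r' _ => by ring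
  have hint : ∀ r r', Integrable (fun ω : ι → S => (c r * c r') * (g (ω r) * A (ω r')))
      (Measure.pi fun _ : ι => π) := fun r r' => by
    have hm : Measurable (fun ω : ι → S => g (ω r) * A (ω r')) :=
      (hg.comp (measurable_pi_apply r)).mul (hAm.comp (measurable_pi_apply r'))
    have hi : Integrable (fun ω : ι → S => g (ω r) * A (ω r')) (Measure.pi fun _ : ι => π) :=
      Scoring.integrable_of_bounded _ hm (C := C * C) fun ω => by
        rw [abs_mul]; exact mul_le_mul (hC _) (hAb _) (abs_nonneg _) hC0
    exact hi.const_mul _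
  rw [hprod, integral_finsetSum _ fun r _ => integrable_finsetSum _ fun r' _ => hint r r']
  simp_rw [integral_finsetSum _ fun r' _ => hint _ r', integral_const_mul]
  have hterm : ∀ r r', ∫ ω, g (ω r) * A (ω r') ∂(Measure.pi fun _ : ι => π)
      = if r = r' then ∫ y, g y * A y ∂π else 0 := by
    intro r r'
    split_ifs with h
    · subst h
      exact integral_comp_eval_pi_fintype r (hg.mul hAm)
    · exact integral_mul_comp_eval_of_ne h hg hAm hg0
  simp_rw [hterm, mul_ite, mul_zero, sum_ite_eq, Finset.mem_univ, if_true, ← sum_mul, sq]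

end Weighted

/-! ## §2 Every linear combination of the replica sums obeys the CLT from any joint start -/

section LinComb

variable {ι : Type*} [DecidableEq ι] [Fintype ι] [Nonempty ι] {S : Type*} [MeasurableSpace S]
  {κ : Kernel S S} [IsMarkovKernel κ] {π : Measure S} [IsProbabilityMeasure π]
  {ν : Measure S} [IsProbabilityMeasure ν] {ε : ℝ≥0∞}

omit [Nonempty ι] in
/-- **CLT FOR LINEAR COMBINATIONS ALONG THE PRODUCT CHAIN, ANY JOINT START**: for every `t : ι → ℝ`,
`(√n)⁻¹ Σ_{s<n} Σ_r t_r (f(X_s(r)) − πf) ⇒ N(0, (Σ_r t_r²)·σ²_f)` (against `id`). -/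
theorem tendstoInDistribution_linComb_productChain (hπ : Kernel.Invariant κ π) (hε : ε ≠ 0)
    (hmin : ∀ z, ε • ν ≤ κ z) {L : List ι} (hL : L.Nodup) (hLall : ∀ r, r ∈ L)
    {f : S → ℝ} (hf : Measurable f) {C : ℝ} (hC : ∀ x, |f x| ≤ C)
    (μ : Measure (ι → S)) [IsProbabilityMeasure μ]
    [IsProbabilityMeasure (Kernel.trajMeasure (X := fun _ : ℕ => ι → S) μ
        (fun n : ℕ => (replicaSweep (fun _ : ι => κ) L).comap
          (fun hh : (i : ↥(Finset.Iic n)) → ι → S => hh ⟨n, Finset.mem_Iic.2 le_rfl⟩)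
          (measurable_pi_apply _)))] (t : ι → ℝ) :
    TendstoInDistribution (fun (n : ℕ) (x : ℕ → ι → S) =>
        (Real.sqrt n)⁻¹ * ∑ s ∈ range n, ∑ r, t r * (f (x s r) - ∫ z, f z ∂π))
      atTop id (fun _ => Kernel.trajMeasure (X := fun _ : ℕ => ι → S) μ
        (fun n : ℕ => (replicaSweep (fun _ : ι => κ) L).comap
          (fun hh : (i : ↥(Finset.Iic n)) → ι → S => hh ⟨n, Finset.mem_Iic.2 le_rfl⟩)
          (measurable_pi_apply _)))
      (gaussianReal 0 (NNReal.mk (∑ r, t r ^ 2) (sum_nonneg fun _ _ => sq_nonneg _)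
        * Real.toNNReal (Scoring.autocov κ π (fun y => f y - ∫ z, f z ∂π) 0
          + 2 * ∑' k, Scoring.autocov κ π (fun y => f y - ∫ z, f z ∂π) (k + 1)))) := by
  set Q : Kernel (ι → S) (ι → S) := replicaSweep (fun _ : ι => κ) L with hQ
  set Pπ : Measure (ι → S) := Measure.pi fun _ : ι => π with hPπ
  have hQπ : Kernel.Invariant Q Pπ := invariant_pi_replicaSweep (fun _ => hπ) L
  have hεL : ε ^ L.length ≠ 0 := pow_ne_zero _ hε
  have hminQ : ∀ ω, ε ^ L.length • (Measure.pi fun _ : ι => ν) ≤ nHit Q 1 ω := fun ω => by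
    rw [nHit_one]
    exact replicaSweep_minorised (K := fun _ : ι => κ) (ν := fun _ : ι => ν) (fun _ x => hmin x)
      hLall ω
  -- the weighted observable and its centring
  set F : (ι → S) → ℝ := fun ω => ∑ r, t r * f (ω r) with hF
  set Ct : ℝ := ∑ r, |t r| with hCt
  have hFm : Measurable F := by
    rw [hF]; exact Finset.measurable_sum _ fun r _ => (hf.comp (measurable_pi_apply r)).const_mul _
  have hFC : ∀ ω, |F ω| ≤ Ct * C := fun ω => by
    rw [hF, hCt, sum_mul]
    calc |∑ r, t r * f (ω r)| ≤ ∑ r, |t r * f (ω r)| := abs_sum_le_sum_abs _ _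
      _ ≤ ∑ r, |t r| * C := sum_le_sum fun r _ => by
          rw [abs_mul]; exact mul_le_mul_of_nonneg_left (hC _) (abs_nonneg _)
  have hint1 : ∀ r : ι, Integrable (fun ω : ι → S => f (ω r)) Pπ := fun r =>
    Scoring.integrable_of_bounded _ (hf.comp (measurable_pi_apply r)) fun ω => hC (ω r)
  have hFmean : ∫ ω, F ω ∂Pπ = ∑ r, t r * ∫ z, f z ∂π := by
    calc ∫ ω, F ω ∂Pπ = ∫ ω, ∑ r, t r * f (ω r) ∂Pπ := rfl
      _ = ∑ r, ∫ ω, t r * f (ω r) ∂Pπ := integral_finsetSum _ fun r _ => (hint1 r).const_mul _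
      _ = ∑ r, t r * ∫ z, f z ∂π := sum_congr rfl fun r _ => by
          rw [integral_const_mul, hPπ, integral_comp_eval_pi_fintype _ hf]
  set g : S → ℝ := fun y => f y - ∫ z, f z ∂π with hg
  have hgm : Measurable g := hf.sub measurable_const
  have hgC : ∀ y, |g y| ≤ 2 * C := fun y => by
    rw [hg]
    have h2 : |∫ z, f z ∂π| ≤ C := by
      rw [← Real.norm_eq_abs]
      calc ‖∫ z, f z ∂π‖ ≤ C * π.real univ := norm_integral_le_of_norm_le_const
            (Eventually.of_forall fun z => by rw [Real.norm_eq_abs]; exact hC z)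
        _ = C := by rw [probReal_univ, mul_one]
    calc |f y - ∫ z, f z ∂π| ≤ |f y| + |∫ z, f z ∂π| := abs_sub _ _
      _ ≤ 2 * C := by linarith [hC y]
  have hg0 : ∫ y, g y ∂π = 0 := by
    rw [hg, integral_sub (Scoring.integrable_of_bounded π hf hC) (integrable_const _), integral_const,
      probReal_univ, one_smul, sub_self]
  have hFbar : (fun ω : ι → S => F ω - ∫ z, F z ∂Pπ) = fun ω => ∑ r, t r * g (ω r) := by
    funext ω
    rw [hFmean, hF, ← sum_sub_distrib]
    exact sum_congr rfl fun r _ => by rw [hg]; ring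
  -- the Green–Kubo variance of `F` along `Q` is `(Σ t_r²) σ²_f`
  have hvar : (∫ ω, (F ω - ∫ z, F z ∂Pπ) ^ 2 ∂Pπ)
      + 2 * ∑' k, ∫ ω, (F ω - ∫ z, F z ∂Pπ)
        * (Scoring.kop Q)^[k + 1] (fun ω => F ω - ∫ z, F z ∂Pπ) ω ∂Pπ
      = (∑ r, t r ^ 2) * (Scoring.autocov κ π g 0 + 2 * ∑' k, Scoring.autocov κ π g (k + 1)) := by
    rw [cltVariance_eq_autocov Q Pπ F, hFbar]
    simp_rw [hQ, hPπ, autocov_replicaSweep_weighted_sum_eq (κ := κ) hL hLall t hgm hgC hg0]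
    rw [tsum_mul_left]
    ring
  have hY : HasLaw (id : ℝ → ℝ) (gaussianReal 0 (Real.toNNReal
      ((∫ ω, (F ω - ∫ z, F z ∂Pπ) ^ 2 ∂Pπ)
      + 2 * ∑' k, ∫ ω, (F ω - ∫ z, F z ∂Pπ)
        * (Scoring.kop Q)^[k + 1] (fun ω => F ω - ∫ z, F z ∂Pπ) ω ∂Pπ)))
      (gaussianReal 0 (NNReal.mk (∑ r, t r ^ 2) (sum_nonneg fun _ _ => sq_nonneg _)
        * Real.toNNReal (Scoring.autocov κ π g 0 + 2 * ∑' k, Scoring.autocov κ π g (k + 1)))) := by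
    rw [hvar, Real.toNNReal_mul (sum_nonneg fun _ _ => sq_nonneg _)]
    have : Real.toNNReal (∑ r, t r ^ 2) = NNReal.mk (∑ r, t r ^ 2) (sum_nonneg fun _ _ => sq_nonneg _) :=
      NNReal.eq (Real.coe_toNNReal _ (sum_nonneg fun _ _ => sq_nonneg _))
    rw [this]
    exact HasLaw.id
  have hclt := tendstoInDistribution_timeAverage_of_nHit hQπ hεL hminQ Nat.one_pos hFm hFC μ hY
  refine hclt.congr (fun n => Eventually.of_forall fun x => ?_) Filter.EventuallyEq.rfl
  congr 1
  refine sum_congr rfl fun s _ => ?_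
  rw [hFmean, hF, ← sum_sub_distrib]
  exact sum_congr rfl fun r _ => by ring

end LinComb

/-! ## §3 The replica vector of the product chain ⇒ the product Gaussian, every joint start -/

section Vector

variable {ι : Type*} [DecidableEq ι] [Fintype ι] [Nonempty ι] {S : Type*} [MeasurableSpace S]
  {κ : Kernel S S} [IsMarkovKernel κ] {π : Measure S} [IsProbabilityMeasure π]
  {ν : Measure S} [IsProbabilityMeasure ν] {ε : ℝ≥0∞}

omit [Nonempty ι] in
/-- **THE REPLICA VECTOR OF THE PRODUCT CHAIN CONVERGES TO `N(0, σ²_f)^{⊗R}` FROM EVERY JOINT INITIAL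
LAW** (Cramér–Wold over §2). -/
theorem tendstoInDistribution_replicaVector_productChain (hπ : Kernel.Invariant κ π) (hε : ε ≠ 0)
    (hmin : ∀ z, ε • ν ≤ κ z) {L : List ι} (hL : L.Nodup) (hLall : ∀ r, r ∈ L)
    {f : S → ℝ} (hf : Measurable f) {C : ℝ} (hC : ∀ x, |f x| ≤ C)
    (μ : Measure (ι → S)) [IsProbabilityMeasure μ]
    [IsProbabilityMeasure (Kernel.trajMeasure (X := fun _ : ℕ => ι → S) μ
        (fun n : ℕ => (replicaSweep (fun _ : ι => κ) L).comap
          (fun hh : (i : ↥(Finset.Iic n)) → ι → S => hh ⟨n, Finset.mem_Iic.2 le_rfl⟩)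
          (measurable_pi_apply _)))] :
    TendstoInDistribution (fun (n : ℕ) (x : ℕ → ι → S) =>
        toLp 2 (fun r => (Real.sqrt n)⁻¹ * ∑ s ∈ range n, (f (x s r) - ∫ z, f z ∂π)))
      atTop (toLp 2) (fun _ => Kernel.trajMeasure (X := fun _ : ℕ => ι → S) μ
        (fun n : ℕ => (replicaSweep (fun _ : ι => κ) L).comap
          (fun hh : (i : ↥(Finset.Iic n)) → ι → S => hh ⟨n, Finset.mem_Iic.2 le_rfl⟩)
          (measurable_pi_apply _)))
      (Measure.pi fun _ : ι => gaussianReal 0 (Real.toNNReal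
        (Scoring.autocov κ π (fun y => f y - ∫ z, f z ∂π) 0
          + 2 * ∑' k, Scoring.autocov κ π (fun y => f y - ∫ z, f z ∂π) (k + 1)))) := by
  have hV : ∀ n : ℕ, Measurable fun (x : ℕ → ι → S) (r : ι) =>
      (Real.sqrt n)⁻¹ * ∑ s ∈ range n, (f (x s r) - ∫ z, f z ∂π) := fun n =>
    measurable_pi_lambda _ fun r => measurable_const.mul (Finset.measurable_sum _ fun s _ =>
      ((hf.comp ((measurable_pi_apply r).comp (measurable_pi_apply s))).sub measurable_const))
  refine tendstoInDistribution_toLp_pi_gaussianReal_of_forall_sum_mul hV fun t => ?_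
  have h := tendstoInDistribution_linComb_productChain hπ hε hmin hL hLall hf hC μ t
  refine h.congr (fun n => Eventually.of_forall fun x => ?_) Filter.EventuallyEq.rfl
  simp only [mul_sum]
  rw [sum_comm]
  exact sum_congr rfl fun s _ => sum_congr rfl fun r _ => by ring

end Vector

/-! ## §4 The replica `t`-statistic and its coverage, dependent starts -/

section TStat

variable {ι : Type*} [DecidableEq ι] [Fintype ι] [Nontrivial ι] {S : Type*} [MeasurableSpace S]
  {κ : Kernel S S} [IsMarkovKernel κ] {π : Measure S} [IsProbabilityMeasure π]
  {ν : Measure S} [IsProbabilityMeasure ν] {ε : ℝ≥0∞}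

/-- **THE REPLICA `t`-STATISTIC OF THE PRODUCT CHAIN ⇒ `t(Z)`, `Z ~ N(0, σ²_f)^{⊗R}`, FROM EVERY JOINT
START** (`R ≥ 2`, `σ²_f > 0`). -/
theorem tendstoInDistribution_replicaTStat_productChain (hπ : Kernel.Invariant κ π) (hε : ε ≠ 0)
    (hmin : ∀ z, ε • ν ≤ κ z) {L : List ι} (hL : L.Nodup) (hLall : ∀ r, r ∈ L)
    {f : S → ℝ} (hf : Measurable f) {C : ℝ} (hC : ∀ x, |f x| ≤ C)
    (hσ : 0 < Scoring.autocov κ π (fun y => f y - ∫ z, f z ∂π) 0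
          + 2 * ∑' t, Scoring.autocov κ π (fun y => f y - ∫ z, f z ∂π) (t + 1))
    (μ : Measure (ι → S)) [IsProbabilityMeasure μ]
    [IsProbabilityMeasure (Kernel.trajMeasure (X := fun _ : ℕ => ι → S) μ
        (fun n : ℕ => (replicaSweep (fun _ : ι => κ) L).comap
          (fun hh : (i : ↥(Finset.Iic n)) → ι → S => hh ⟨n, Finset.mem_Iic.2 le_rfl⟩)
          (measurable_pi_apply _)))] :
    TendstoInDistribution (fun (n : ℕ) (x : ℕ → ι → S) =>
        ((∑ r, (∑ s ∈ range n, f (x s r)) / n) / Fintype.card ι - ∫ z, f z ∂π)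
          / Real.sqrt ((∑ r, ((∑ s ∈ range n, f (x s r)) / n
              - (∑ r', (∑ s ∈ range n, f (x s r')) / n) / Fintype.card ι) ^ 2)
              / ((Fintype.card ι : ℝ) * (Fintype.card ι - 1))))
      atTop
      (fun z : ι → ℝ => (∑ r, z r) / Fintype.card ι
        / Real.sqrt ((∑ r, (z r - (∑ r', z r') / Fintype.card ι) ^ 2)
            / ((Fintype.card ι : ℝ) * (Fintype.card ι - 1))))
      (fun _ => Kernel.trajMeasure (X := fun _ : ℕ => ι → S) μ
        (fun n : ℕ => (replicaSweep (fun _ : ι => κ) L).comap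
          (fun hh : (i : ↥(Finset.Iic n)) → ι → S => hh ⟨n, Finset.mem_Iic.2 le_rfl⟩)
          (measurable_pi_apply _)))
      (Measure.pi fun _ : ι => gaussianReal 0 (Real.toNNReal
        (Scoring.autocov κ π (fun y => f y - ∫ z, f z ∂π) 0
          + 2 * ∑' t, Scoring.autocov κ π (fun y => f y - ∫ z, f z ∂π) (t + 1)))) := by
  haveI : Nonempty ι := inferInstance
  have hv : Real.toNNReal (Scoring.autocov κ π (fun y => f y - ∫ z, f z ∂π) 0
      + 2 * ∑' t, Scoring.autocov κ π (fun y => f y - ∫ z, f z ∂π) (t + 1)) ≠ 0 := by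
    rw [ne_eq, Real.toNNReal_eq_zero, not_le]
    exact hσ
  have h := tendstoInDistribution_tStat_of_pi_gaussianReal' hv
    (tendstoInDistribution_replicaVector_productChain hπ hε hmin hL hLall hf hC μ)
  have heq : (fun (n : ℕ) (x : ℕ → ι → S) =>
        ((∑ r, (∑ s ∈ range n, f (x s r)) / n) / Fintype.card ι - ∫ z, f z ∂π)
          / Real.sqrt ((∑ r, ((∑ s ∈ range n, f (x s r)) / n
              - (∑ r', (∑ s ∈ range n, f (x s r')) / n) / Fintype.card ι) ^ 2)
              / ((Fintype.card ι : ℝ) * (Fintype.card ι - 1))))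
      = fun (n : ℕ) (x : ℕ → ι → S) =>
        (∑ r, (Real.sqrt n)⁻¹ * ∑ s ∈ range n, (f (x s r) - ∫ z, f z ∂π)) / Fintype.card ι
          / Real.sqrt ((∑ r, ((Real.sqrt n)⁻¹ * ∑ s ∈ range n, (f (x s r) - ∫ z, f z ∂π)
              - (∑ r', (Real.sqrt n)⁻¹ * ∑ s ∈ range n, (f (x s r') - ∫ z, f z ∂π))
                / Fintype.card ι) ^ 2)
              / ((Fintype.card ι : ℝ) * (Fintype.card ι - 1))) := by
    funext n x
    exact (tStat_replicaVector_eq (fun r s => f (x s r)) (∫ z, f z ∂π) n).symm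
  rw [heq]
  exact h

/-- **… AND THE REPLICA-`t` / JACKKNIFE BAR KEEPS ITS UNIVERSAL LIMITING COVERAGE `L_R(q)` WITH
DEPENDENT STARTS**: `κ` Markov, `π` invariant, `κ(z,·) ≥ ε ν` (`ε ≠ 0`), `|f| ≤ C`, `σ²_f > 0`,
`R = card ι ≥ 2`, product chain from ANY joint law `μ`, `q ≥ 0`:
`P(|((1/R)Σ_r ȳ_{r,n} − πf)/√(Σ_r (ȳ_{r,n} − ȳ̄_n)²/(R(R−1)))| ≤ q) → N(0,1)^{⊗R}{|t| ≤ q}`. -/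
theorem tendsto_measure_abs_replicaTStat_le_productChain (hπ : Kernel.Invariant κ π) (hε : ε ≠ 0)
    (hmin : ∀ z, ε • ν ≤ κ z) {L : List ι} (hL : L.Nodup) (hLall : ∀ r, r ∈ L)
    {f : S → ℝ} (hf : Measurable f) {C : ℝ} (hC : ∀ x, |f x| ≤ C)
    (hσ : 0 < Scoring.autocov κ π (fun y => f y - ∫ z, f z ∂π) 0
          + 2 * ∑' t, Scoring.autocov κ π (fun y => f y - ∫ z, f z ∂π) (t + 1))
    (μ : Measure (ι → S)) [IsProbabilityMeasure μ]
    [IsProbabilityMeasure (Kernel.trajMeasure (X := fun _ : ℕ => ι → S) μ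
        (fun n : ℕ => (replicaSweep (fun _ : ι => κ) L).comap
          (fun hh : (i : ↥(Finset.Iic n)) → ι → S => hh ⟨n, Finset.mem_Iic.2 le_rfl⟩)
          (measurable_pi_apply _)))] {q : ℝ} (hq : 0 ≤ q) :
    Tendsto (fun n : ℕ => (Kernel.trajMeasure (X := fun _ : ℕ => ι → S) μ
        (fun n : ℕ => (replicaSweep (fun _ : ι => κ) L).comap
          (fun hh : (i : ↥(Finset.Iic n)) → ι → S => hh ⟨n, Finset.mem_Iic.2 le_rfl⟩)
          (measurable_pi_apply _)))
        {x : ℕ → ι → S | |((∑ r, (∑ s ∈ range n, f (x s r)) / n) / Fintype.card ι - ∫ z, f z ∂π)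
          / Real.sqrt ((∑ r, ((∑ s ∈ range n, f (x s r)) / n
              - (∑ r', (∑ s ∈ range n, f (x s r')) / n) / Fintype.card ι) ^ 2)
              / ((Fintype.card ι : ℝ) * (Fintype.card ι - 1)))| ≤ q})
      atTop
      (𝓝 ((Measure.pi fun _ : ι => gaussianReal 0 1) {z : ι → ℝ | |(∑ r, z r) / Fintype.card ι
        / Real.sqrt ((∑ r, (z r - (∑ r', z r') / Fintype.card ι) ^ 2)
            / ((Fintype.card ι : ℝ) * (Fintype.card ι - 1)))| ≤ q})) := by
  haveI : Nonempty ι := inferInstance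
  have hv : Real.toNNReal (Scoring.autocov κ π (fun y => f y - ∫ z, f z ∂π) 0
      + 2 * ∑' t, Scoring.autocov κ π (fun y => f y - ∫ z, f z ∂π) (t + 1)) ≠ 0 := by
    rw [ne_eq, Real.toNNReal_eq_zero, not_le]
    exact hσ
  have h := tendsto_measure_abs_tStat_le_of_pi_gaussianReal hv
    (tendstoInDistribution_replicaVector_productChain hπ hε hmin hL hLall hf hC μ) hq
  rw [pi_gaussianReal_measure_abs_tStat_le_eq hv] at h
  refine h.congr fun n => ?_
  congr 1
  ext x
  simp only [Set.mem_setOf_eq]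
  rw [← tStat_replicaVector_eq (fun r s => f (x s r)) (∫ z, f z ∂π) n]

end TStat

end Summit.Ventures.LatticeQCDFlow.Exactness.GeneralNCMC
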